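import Mathlib
import HarnessLib
import Summits.CriticalPhenomena.SAWScalingLimit.Theorems.SAWLoopLiftWernerDeterminationTopology
import Summits.CriticalPhenomena.SAWScalingLimit.Theorems.SAWLoopLiftWernerDeterminationHyperspace
import Summits.CriticalPhenomena.SAWScalingLimit.Theorems.SAWLoopLiftWernerDeterminationExhaustion

/-!
# Werner determination (route SAWLoopLift, item stmt-CriticalPhenomena-4851) — transfer of masses from
Jordan pairs to open sets without holes

Helper file (`--supports stmt-CriticalPhenomena-4851`). Two measures `ν, ν'` on `NonemptyCompacts ℂ` are
assumed to agree, with finite common value, on the events of the route item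
`E(U, V, z) = {T ⊆ U ∧ z ∉ T ∧ cc(Tᶜ, z) bounded ∧ ¬ T ⊆ V}` for all JORDAN domains `V ⊆ U ⊆ B(0, R)` and
`z ∈ V` (hypothesis `hJ`; the main file derives it from the conformal-radius masses and the Riemann
mapping theorem), and to be carried by connected compact sets. We prove (Werner 2008, proof of Lemma 4,
"exhaust simply connected domains by Jordan subdomains; finiteness from the masses"):

* `measure_around_diff_eq_of_exhaustion` — agreement (and finiteness) on `{T ⊆ G, T surrounds q, ¬ T ⊆ B(q, ρ)}`
  for every bounded SIMPLY CONNECTED domain `G ⊆ B(0, R)` with `closedBall q ρ ⊆ G`: `G` is an increasing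
  union of Jordan domains (`exists_jordanDomain_exhaustion`), continuity of measures from below;
* `measure_around_inter_event_eq` — agreement on `{T ⊆ W, T surrounds q} ∩ E(B(0,R), B(q,r), q)` for every
  OPEN SET `W` WITHOUT HOLES: connected sets surrounding `q` inside `W ∩ B(0,R)` lie in the component of
  `q`, which is simply connected (`isSimplyConnected_connectedComponentIn`), and the event is, almost
  everywhere, a proper difference of two events of the first kind.

These are the values of `ν, ν'` on the traces of the π-system `piSys q` on the pieces of the countable
cover used in the main file. No new definitions. Reference: W. Werner, J. Amer. Math. Soc. 21 (2008), §3.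
-/

noncomputable section

namespace Summit.CriticalPhenomena.SAWScalingLimit.Theorems.WernerDetermination

open Set Metric Bornology Topology Filter TopologicalSpace MeasureTheory
open scoped ENNReal
open Literature.Probability.RandomPlanarGeometry

/-- The event "`T ⊆ W` and `T` surrounds `z`" of the route item (local notation). -/
local notation3 "around " z " inW " W => {T : NonemptyCompacts ℂ | (T : Set ℂ) ⊆ W ∧ z ∉ (T : Set ℂ) ∧
  IsBounded (connectedComponentIn (T : Set ℂ)ᶜ z)}

/-- The event `E(U, V, z)` of the route item (local notation). -/
local notation3 "evt " z " inW " U " notIn " V => {T : NonemptyCompacts ℂ | (T : Set ℂ) ⊆ U ∧ z ∉ (T : Set ℂ) ∧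
  IsBounded (connectedComponentIn (T : Set ℂ)ᶜ z) ∧ ¬ (T : Set ℂ) ⊆ V}

/-- Monotonicity of the surrounding events in the open set. [folklore] -/
theorem around_mono (z : ℂ) {W W' : Set ℂ} (h : W ⊆ W') : (around z inW W) ⊆ around z inW W' :=
  fun _ hT => ⟨hT.1.trans h, hT.2.1, hT.2.2⟩

/-- The item's event is the surrounding event minus `{T ⊆ V}`. [folklore] -/
theorem evt_eq_diff (z : ℂ) (U V : Set ℂ) :
    (evt z inW U notIn V) = (around z inW U) \ {T : NonemptyCompacts ℂ | (T : Set ℂ) ⊆ V} := by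
  ext T; simp only [mem_setOf_eq, Set.mem_sdiff]; tauto

/-- Shifting a monotone sequence does not change its supremum. [folklore] -/
theorem iSup_eq_iSup_add {f : ℕ → ℝ≥0∞} (hf : Monotone f) (n₀ : ℕ) : ⨆ m, f m = ⨆ m, f (m + n₀) :=
  le_antisymm (iSup_le fun m => (hf (Nat.le_add_right m n₀)).trans (le_iSup (fun m => f (m + n₀)) m))
    (iSup_le fun m => le_iSup f (m + n₀))

variable [MeasurableSpace (NonemptyCompacts ℂ)] [BorelSpace (NonemptyCompacts ℂ)]

omit [BorelSpace (NonemptyCompacts ℂ)] in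
/-- **Agreement on simply connected domains by exhaustion** (Werner 2008, proof of Lemma 4). If `ν, ν'`
agree with finite value on the events `E(U, V, z)` of all Jordan pairs in `B(0, R)`, then for every
bounded simply connected domain `G ⊆ B(0, R)`, `q ∈ G` and `closedBall q ρ ⊆ G` (`0 < ρ`) they agree, with
finite value, on `{T ⊆ G, T surrounds q} \ {T ⊆ B(q, ρ)}`: this event is the increasing union over an
exhaustion of `G` by Jordan domains `U n ⊇ closedBall q ρ` of the events `E(U n, B(q, ρ), q)`. [folklore] -/
theorem measure_around_diff_eq_of_exhaustion {ν ν' : Measure (NonemptyCompacts ℂ)} {R : ℝ}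
    (hJ : ∀ (U V : JordanDomain) (z : ℂ), U.carrier ⊆ ball 0 R → V.carrier ⊆ U.carrier → z ∈ V.carrier →
      ν (evt z inW U.carrier notIn V.carrier) = ν' (evt z inW U.carrier notIn V.carrier) ∧
        ν (evt z inW U.carrier notIn V.carrier) < ∞)
    {G : Set ℂ} (hGo : IsOpen G) (hsc : IsSimplyConnected G) (hGR : G ⊆ ball 0 R)
    {q : ℂ} {ρ : ℝ} (hρ : 0 < ρ) (hρG : closedBall q ρ ⊆ G) :
    ν ((around q inW G) \ {T : NonemptyCompacts ℂ | (T : Set ℂ) ⊆ ball q ρ}) =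
      ν' ((around q inW G) \ {T : NonemptyCompacts ℂ | (T : Set ℂ) ⊆ ball q ρ}) ∧
    ν ((around q inW G) \ {T : NonemptyCompacts ℂ | (T : Set ℂ) ⊆ ball q ρ}) < ∞ := by
  have hqG : q ∈ G := hρG (mem_closedBall_self hρ.le)
  have hR : 0 < R := by
    have : (ball (0 : ℂ) R).Nonempty := ⟨q, hGR hqG⟩
    exact nonempty_ball.1 this
  obtain ⟨U, hUG, hUmono, -, hUK⟩ :=
    exists_jordanDomain_exhaustion hGo hsc (isBounded_ball.subset hGR) hqG
  obtain ⟨V, hV⟩ := exists_jordanDomain_carrier_eq_ball q hρ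
  obtain ⟨UR, hUR⟩ := exists_jordanDomain_carrier_eq_ball (0 : ℂ) hR
  obtain ⟨n₀, hn₀⟩ := hUK (closedBall q ρ) (isCompact_closedBall q ρ) hρG
  set S : ℕ → Set (NonemptyCompacts ℂ) :=
    fun m => (around q inW (U m).carrier) \ {T : NonemptyCompacts ℂ | (T : Set ℂ) ⊆ ball q ρ} with hS
  have hSevt : ∀ m, S m = evt q inW (U m).carrier notIn V.carrier := fun m => by
    rw [hV, evt_eq_diff]
  have hagree : ∀ m, n₀ ≤ m → ν (S m) = ν' (S m) ∧ ν (S m) < ∞ := fun m hm => by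
    rw [hSevt]
    refine hJ (U m) V q ((hUG m).trans hGR) ?_ ?_
    · rw [hV]; exact ball_subset_closedBall.trans (hn₀ m hm)
    · rw [hV]; exact mem_ball_self hρ
  have hmono : Monotone S := fun m n hmn => sdiff_subset_sdiff_left (around_mono q (hUmono m n hmn))
  have hUnion : (around q inW G) \ {T : NonemptyCompacts ℂ | (T : Set ℂ) ⊆ ball q ρ} = ⋃ m, S m := by
    ext T
    simp only [hS, Set.mem_sdiff, mem_iUnion, mem_setOf_eq]
    constructor
    · rintro ⟨⟨hTG, hq, hb⟩, hnot⟩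
      obtain ⟨n, hn⟩ := hUK (T : Set ℂ) T.isCompact hTG
      exact ⟨n, ⟨hn n le_rfl, hq, hb⟩, hnot⟩
    · rintro ⟨m, ⟨hTU, hq, hb⟩, hnot⟩
      exact ⟨⟨hTU.trans (hUG m), hq, hb⟩, hnot⟩
  have hν : ν (⋃ m, S m) = ⨆ m, ν (S (m + n₀)) := by
    rw [hmono.measure_iUnion, iSup_eq_iSup_add (fun m n h => measure_mono (hmono h)) n₀]
  have hν' : ν' (⋃ m, S m) = ⨆ m, ν' (S (m + n₀)) := by
    rw [hmono.measure_iUnion, iSup_eq_iSup_add (fun m n h => measure_mono (hmono h)) n₀]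
  rw [hUnion, hν, hν']
  refine ⟨iSup_congr fun m => (hagree (m + n₀) (Nat.le_add_left n₀ m)).1, ?_⟩
  -- finiteness: every term lies below the mass of the Jordan pair `(B(0,R), B(q,ρ))`
  have hVUR : V.carrier ⊆ UR.carrier := by
    rw [hV, hUR]; exact (ball_subset_closedBall.trans hρG).trans hGR
  have hbig := hJ UR V q (by rw [hUR]) hVUR (by rw [hV]; exact mem_ball_self hρ)
  refine lt_of_le_of_lt (iSup_le fun m => measure_mono ?_) hbig.2
  rw [hSevt]
  rintro T ⟨hTU, hq, hb, hnot⟩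
  exact ⟨hTU.trans (((hUG _).trans hGR).trans_eq hUR.symm), hq, hb, hnot⟩

/-- **Agreement on the traces of the π-system on the cover pieces** (Werner 2008, proof of Lemma 4). Under
the Jordan-pair agreement `hJ` and if `ν, ν'` are carried by connected compact sets, then for every open
set `W` without holes, every `q` and `0 < r` with `B(q, r) ⊆ B(0, R)`:
`ν ({T ⊆ W, T surrounds q} ∩ E(B(0,R), B(q,r), q)) = ν' (…)`. Proof: with `O = W ∩ B(0,R)` (open, no
holes) the event is `{T ⊆ O, T surrounds q} \ {T ⊆ B(q,r)}`; it is empty unless `q ∈ O`; a connected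
`T` surrounding `q` in `O` lies in the simply connected component `C` of `q`, and one in `C ∩ B(q,r)` lies
in the simply connected component `C'` of `q` there; so almost everywhere the event equals
`({T ⊆ C, surr} \ {T ⊆ B(q,ρ)}) \ ({T ⊆ C', surr} \ {T ⊆ B(q,ρ)})` for a small closed disc
`closedBall q ρ ⊆ C'`, a proper difference of two events handled by
`measure_around_diff_eq_of_exhaustion`. [folklore] -/
theorem measure_around_inter_event_eq {ν ν' : Measure (NonemptyCompacts ℂ)} {R : ℝ}
    (hJ : ∀ (U V : JordanDomain) (z : ℂ), U.carrier ⊆ ball 0 R → V.carrier ⊆ U.carrier → z ∈ V.carrier →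
      ν (evt z inW U.carrier notIn V.carrier) = ν' (evt z inW U.carrier notIn V.carrier) ∧
        ν (evt z inW U.carrier notIn V.carrier) < ∞)
    (hconn : ∀ᵐ T : NonemptyCompacts ℂ ∂ν, IsPreconnected (T : Set ℂ))
    (hconn' : ∀ᵐ T : NonemptyCompacts ℂ ∂ν', IsPreconnected (T : Set ℂ))
    {q : ℂ} {r : ℝ} (hr : 0 < r) {W : Set ℂ} (hWo : IsOpen W)
    (hW : ∀ a ∈ Wᶜ, ¬ IsBounded (connectedComponentIn Wᶜ a)) :
    ν ((around q inW W) ∩ (evt q inW (ball 0 R) notIn (ball q r))) =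
      ν' ((around q inW W) ∩ (evt q inW (ball 0 R) notIn (ball q r))) := by
  set O : Set ℂ := W ∩ ball 0 R with hO
  have hOo : IsOpen O := hWo.inter isOpen_ball
  have hOh : ∀ a ∈ Oᶜ, ¬ IsBounded (connectedComponentIn Oᶜ a) :=
    forall_not_isBounded_inter hW (forall_not_isBounded_ball 0 R)
  have hset : (around q inW W) ∩ (evt q inW (ball 0 R) notIn (ball q r)) =
      (around q inW O) \ {T : NonemptyCompacts ℂ | (T : Set ℂ) ⊆ ball q r} := by
    ext T; simp only [hO, mem_inter_iff, mem_setOf_eq, Set.mem_sdiff, subset_inter_iff]; tauto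
  rw [hset]
  by_cases hqO : q ∈ O
  swap
  · -- no compact set surrounds `q` inside a set without holes not containing `q`
    have h0 : (around q inW O) = ∅ := by
      ext T
      simp only [mem_setOf_eq, mem_empty_iff_false, iff_false, not_and]
      exact fun hTO _ hb => hqO (mem_of_forall_not_isBounded hOh hTO hb)
    rw [h0, empty_sdiff, measure_empty, measure_empty]
  -- the component of `q` in `O` and in `C ∩ B(q, r)`
  set C : Set ℂ := connectedComponentIn O q with hC
  have hCo : IsOpen C := hOo.connectedComponentIn
  have hCsc : IsSimplyConnected C := isSimplyConnected_connectedComponentIn hOo hOh hqO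
  have hCO : C ⊆ O := connectedComponentIn_subset _ _
  have hCR : C ⊆ ball 0 R := hCO.trans inter_subset_right
  have hqC : q ∈ C := mem_connectedComponentIn hqO
  have hCh : ∀ a ∈ Cᶜ, ¬ IsBounded (connectedComponentIn Cᶜ a) :=
    forall_not_isBounded_connectedComponentIn hOo hOh q
  set O' : Set ℂ := C ∩ ball q r with hO'
  have hO'o : IsOpen O' := hCo.inter isOpen_ball
  have hO'h : ∀ a ∈ O'ᶜ, ¬ IsBounded (connectedComponentIn O'ᶜ a) :=
    forall_not_isBounded_inter hCh (forall_not_isBounded_ball q r)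
  have hqO' : q ∈ O' := ⟨hqC, mem_ball_self hr⟩
  set C' : Set ℂ := connectedComponentIn O' q with hC'
  have hC'o : IsOpen C' := hO'o.connectedComponentIn
  have hC'sc : IsSimplyConnected C' := isSimplyConnected_connectedComponentIn hO'o hO'h hqO'
  have hC'O' : C' ⊆ O' := connectedComponentIn_subset _ _
  have hC'C : C' ⊆ C := hC'O'.trans inter_subset_left
  have hqC' : q ∈ C' := mem_connectedComponentIn hqO'
  obtain ⟨ρ, hρ, hρC'⟩ := nhds_basis_closedBall.mem_iff.1 (hC'o.mem_nhds hqC')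
  have hρC : closedBall q ρ ⊆ C := hρC'.trans hC'C
  have hballρ : ball q ρ ⊆ ball q r :=
    (ball_subset_closedBall.trans hρC').trans (hC'O'.trans inter_subset_right)
  -- the almost-everywhere identity on connected sets
  set B : Set (NonemptyCompacts ℂ) := {T : NonemptyCompacts ℂ | (T : Set ℂ) ⊆ ball q ρ} with hB
  have key : ∀ T : NonemptyCompacts ℂ, IsPreconnected (T : Set ℂ) →
      (T ∈ (around q inW O) \ {T : NonemptyCompacts ℂ | (T : Set ℂ) ⊆ ball q r} ↔
        T ∈ ((around q inW C) \ B) \ ((around q inW C') \ B)) := by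
    intro T hT
    simp only [Set.mem_sdiff, mem_setOf_eq, hB, not_and, not_not]
    constructor
    · rintro ⟨⟨hTO, hq, hb⟩, hnot⟩
      have hTC : (T : Set ℂ) ⊆ C :=
        subset_connectedComponentIn_of_surround hOh hTO T.isCompact.isClosed hT hq hb
      refine ⟨⟨⟨hTC, hq, hb⟩, fun h => hnot (h.trans hballρ)⟩, ?_⟩
      rintro ⟨hTC', -, -⟩
      exact absurd (hTC'.trans (hC'O'.trans inter_subset_right)) hnot
    · rintro ⟨⟨⟨hTC, hq, hb⟩, hnotρ⟩, h2⟩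
      refine ⟨⟨hTC.trans hCO, hq, hb⟩, fun hTr => ?_⟩
      have hTC' : (T : Set ℂ) ⊆ C' :=
        subset_connectedComponentIn_of_surround hO'h (subset_inter hTC hTr) T.isCompact.isClosed hT hq hb
      exact hnotρ (h2 ⟨hTC', hq, hb⟩)
  have hae : ((around q inW O) \ {T : NonemptyCompacts ℂ | (T : Set ℂ) ⊆ ball q r} : Set (NonemptyCompacts ℂ))
      =ᵐ[ν] (((around q inW C) \ B) \ ((around q inW C') \ B) : Set (NonemptyCompacts ℂ)) :=
    hconn.mono fun T hT => propext (key T hT)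
  have hae' : ((around q inW O) \ {T : NonemptyCompacts ℂ | (T : Set ℂ) ⊆ ball q r} : Set (NonemptyCompacts ℂ))
      =ᵐ[ν'] (((around q inW C) \ B) \ ((around q inW C') \ B) : Set (NonemptyCompacts ℂ)) :=
    hconn'.mono fun T hT => propext (key T hT)
  rw [measure_congr hae, measure_congr hae']
  -- the two events of the first kind
  obtain ⟨hCeq, -⟩ := measure_around_diff_eq_of_exhaustion hJ hCo hCsc hCR hρ hρC
  obtain ⟨hC'eq, hC'fin⟩ := measure_around_diff_eq_of_exhaustion hJ hC'o hC'sc (hC'C.trans hCR) hρ hρC'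
  have hsub : (around q inW C') \ B ⊆ (around q inW C) \ B := sdiff_subset_sdiff_left (around_mono q hC'C)
  have hmeas : MeasurableSet ((around q inW C') \ B) :=
    (measurableSet_around q hC'o).diff (NonemptyCompacts.isOpen_subsets_of_isOpen isOpen_ball).measurableSet
  have hC'fin' : ν' ((around q inW C') \ B) < ∞ := hC'eq ▸ hC'fin
  rw [measure_sdiff hsub hmeas.nullMeasurableSet hC'fin.ne, measure_sdiff hsub hmeas.nullMeasurableSet hC'fin'.ne,
    hCeq, hC'eq]

end Summit.CriticalPhenomena.SAWScalingLimit.Theorems.WernerDetermination
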